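import Literature.ComputerArithmetic.Rump2006.CholeskyStoredZeros
import Literature.ComputerArithmetic.Rump2026SparseI.SparseCholeskyCertificate
import HarnessLib

/-!
# Stored zeros of a SPARSE floating-point Cholesky factor (Rump 2026 I, Lemma 2.10 floor)

The sparse reading of `Literature.ComputerArithmetic.Rump2006.CholeskyStoredZeros`: the row-count
certificate of [Rump2026SparseI] (Lemma 2.10 (2.15), `SparseCholeskyRun`, the `alpha_rump2026` floor of
cap.ila.spd) assumes the standard model WITHOUT underflow for every quotient `r̃_{ij} = fl(s̃ / r̃_{ii})`.
A library factor (CHOLMOD, relaxed supernodes) stores explicit zeros; a stored zero whose numerator was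
flushed to zero by underflow only satisfies an ABSOLUTE bound `|s̃_{ij}| ≤ E_{ij}` ((1.1) of [Rump2006]
WITH its underflow unit). `SparseCholeskyRunFlush` records exactly that; by the re-centring lemma
`CTree.exists_recentre` such a run is an `eta`-free `SparseCholeskyRun` (same factor, same pattern sets)
of a nearby symmetric datum (`exists_sparseCholeskyRun`), so the MEMBERS floor
(`sub_sub_mul_lt_quadForm_of_rowCounts_members`, Rump 2006 Cor 2.7 dress) absorbs the stored zeros as
an extra radius `r_E` with its own Collatz pair (`sub_sub_mul_lt_quadForm_of_rowCounts_flush`) — the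
`checks.eta_allowance` of cap.ila.spd ≥ 0.2.1. [cite: Rump2026SparseI, Lemma 2.10 (2.15)]
[cite: Rump2006, (1.1) and Corollary 2.7]
-/

namespace Literature.ComputerArithmetic.Rump2026SparseI

open Finset Matrix
open Literature.ComputerArithmetic.Higham2002
open Literature.ComputerArithmetic.Rump2006

variable {K : Type*} [Field K] [LinearOrder K] [IsStrictOrderedRing K]

section Flush

variable {u : K} {n : ℕ}

/-- RUMP 2026 I LEMMA 2.10's floating-point sparse Cholesky run (`SparseCholeskyRun`: any order, fused
operations allowed, pattern sets `S i j`) except that a stored off-diagonal entry may be a ZERO whose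
numerator is only bounded absolutely, `r̃_{ij} = 0 ∧ |s̃_{ij}| ≤ E_{ij}` (quotient flushed to zero by
underflow, or an exact zero). [cite: Rump2026SparseI, Lemma 2.10] [cite: Rump2006, (1.1), (2.1) and (2.6)] -/
structure SparseCholeskyRunFlush (u : K) (E A R : Matrix (Fin n) (Fin n) K)
    (S : Fin n → Fin n → Finset (Fin n)) : Prop where
  lower : ∀ i j : Fin n, j < i → R i j = 0
  subset : ∀ i j : Fin n, i ≤ j → ∀ k ∈ S i j, k < i
  zero : ∀ i j : Fin n, i ≤ j → ∀ k : Fin n, k < i → k ∉ S i j → R k i * R k j = 0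
  offDiag : ∀ i j : Fin n, i < j → ∃ e : CTree K, e.WF u ∧ e.const = A i j ∧
    e.terms.Perm (sprods R (S i j) i j) ∧ R i i ≠ 0 ∧
    (|R i j - e.val / R i i| ≤ u * |e.val / R i i| ∨ (R i j = 0 ∧ |e.val| ≤ E i j))
  diag : ∀ j : Fin n, ∃ e : CTree K, e.WF u ∧ e.const = A j j ∧ e.terms.Perm (sprods R (S j j) j j) ∧
    ∃ δ : K, |δ| ≤ u ∧ R j j ^ 2 = e.val * (1 + δ) ^ 2

omit [IsStrictOrderedRing K] in
/-- An `eta`-free sparse run is a flush run for every allowance `E`. [cite: Rump2026SparseI, Lemma 2.10] -/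
theorem SparseCholeskyRun.toFlush {E A R : Matrix (Fin n) (Fin n) K}
    {S : Fin n → Fin n → Finset (Fin n)} (h : SparseCholeskyRun u A R S) :
    SparseCholeskyRunFlush u E A R S where
  lower := h.lower
  subset := h.subset
  zero := h.zero
  offDiag i j hij := by
    obtain ⟨e, he, hc, hp, hii, hr⟩ := h.offDiag i j hij
    exact ⟨e, he, hc, hp, hii, Or.inl hr⟩
  diag := h.diag

/-- per-entry re-centring: in stage `(i, j)`, `i < j`, of a sparse flush run there is a datum `c`,
`|c - a_{ij}| (1-u)^n ≤ E_{ij}`, for which the SAME stored `r̃_{ij}` is an `eta`-free standard-model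
quotient over the SAME pattern set. [cite: Rump2026SparseI, Lemma 2.10] [cite: Rump2006, Lemma 2.1 and (1.1)] -/
theorem SparseCholeskyRunFlush.exists_const (hu : 0 ≤ u) (hu1 : u < 1)
    {E A R : Matrix (Fin n) (Fin n) K} {S : Fin n → Fin n → Finset (Fin n)}
    (hE0 : ∀ i j, 0 ≤ E i j) (h : SparseCholeskyRunFlush u E A R S) (i j : Fin n) (hij : i < j) :
    ∃ c : K, (∃ e : CTree K, e.WF u ∧ e.const = c ∧ e.terms.Perm (sprods R (S i j) i j) ∧
      R i i ≠ 0 ∧ |R i j - e.val / R i i| ≤ u * |e.val / R i i|) ∧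
      |c - A i j| * (1 - u) ^ n ≤ E i j := by
  obtain ⟨e, he, hc, hp, hii, hr⟩ := h.offDiag i j hij
  rcases hr with hr | ⟨hz, hE⟩
  · refine ⟨A i j, ⟨e, he, hc, hp, hii, hr⟩, ?_⟩
    rw [sub_self, abs_zero, zero_mul]
    exact hE0 i j
  · obtain ⟨e', he', hterms, hval, hconst⟩ := CTree.exists_recentre hu hu1 e he e.val
    have hlen : e.terms.length ≤ n := by
      rw [hp.length_eq, length_sprods]
      exact (Finset.card_le_univ _).trans_eq (Fintype.card_fin n)
    refine ⟨e'.const, ⟨e', he', rfl, hterms ▸ hp, hii, ?_⟩, ?_⟩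
    · rw [hval, sub_self, zero_div, hz, sub_zero, abs_zero, mul_zero]
    · have h1u : 0 < 1 - u := by linarith
      have hpow : (1 - u) ^ n ≤ (1 - u) ^ e.terms.length :=
        pow_le_pow_of_le_one h1u.le (by linarith) hlen
      calc |e'.const - A i j| * (1 - u) ^ n
          ≤ |e'.const - A i j| * (1 - u) ^ e.terms.length :=
            mul_le_mul_of_nonneg_left hpow (abs_nonneg _)
        _ = |e'.const - e.const| * (1 - u) ^ e.terms.length := by rw [hc]
        _ ≤ |e.val| := hconst
        _ ≤ E i j := hE

/-- STORED ZEROS COST A RADIUS (sparse form): a sparse flush run of a symmetric `A` with allowance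
`E ≥ 0` is an `eta`-free `SparseCholeskyRun` — same factor `R̃`, same pattern sets `S` — of a SYMMETRIC
`A'` with the same diagonal and `|A' - A| (1-u)^n ≤ E` entrywise (`E` read symmetrically from its upper
triangle). [cite: Rump2026SparseI, Lemma 2.10] [cite: Rump2006, Lemma 2.1, (1.1) and Corollary 2.7] -/
theorem SparseCholeskyRunFlush.exists_sparseCholeskyRun (hu : 0 ≤ u) (hu1 : u < 1)
    {E A R : Matrix (Fin n) (Fin n) K} {S : Fin n → Fin n → Finset (Fin n)} (hA : Aᵀ = A)
    (hE0 : ∀ i j, 0 ≤ E i j) (h : SparseCholeskyRunFlush u E A R S) :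
    ∃ A' : Matrix (Fin n) (Fin n) K, A'ᵀ = A' ∧ SparseCholeskyRun u A' R S ∧
      (∀ i, A' i i = A i i) ∧
      ∀ i j, |A' i j - A i j| * (1 - u) ^ n ≤ (if i < j then E i j else E j i) := by
  classical
  have hsym : ∀ i j, A i j = A j i := fun i j => by
    have := congrFun (congrFun hA j) i
    rwa [Matrix.transpose_apply] at this
  let c : ∀ i j : Fin n, i < j → K := fun i j hij =>
    Classical.choose (h.exists_const hu hu1 hE0 i j hij)
  have hc : ∀ i j (hij : i < j), (∃ e : CTree K, e.WF u ∧ e.const = c i j hij ∧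
      e.terms.Perm (sprods R (S i j) i j) ∧ R i i ≠ 0 ∧
      |R i j - e.val / R i i| ≤ u * |e.val / R i i|) ∧ |c i j hij - A i j| * (1 - u) ^ n ≤ E i j :=
    fun i j hij => Classical.choose_spec (h.exists_const hu hu1 hE0 i j hij)
  let A' : Matrix (Fin n) (Fin n) K := fun i j =>
    if hij : i < j then c i j hij else if hji : j < i then c j i hji else A i j
  have hup : ∀ i j (hij : i < j), A' i j = c i j hij := fun i j hij => by
    simp only [A', dif_pos hij]
  have hlo : ∀ i j (hji : j < i), A' i j = c j i hji := fun i j hji => by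
    simp only [A', dif_neg (lt_asymm hji), dif_pos hji]
  have hdg : ∀ i, A' i i = A i i := fun i => by
    simp only [A', dif_neg (lt_irrefl i)]
  refine ⟨A', ?_, ⟨h.lower, h.subset, h.zero, ?_, ?_⟩, hdg, ?_⟩
  · ext i j
    rw [Matrix.transpose_apply]
    rcases lt_trichotomy i j with hij | rfl | hji
    · rw [hup i j hij, hlo j i hij]
    · rfl
    · rw [hlo i j hji, hup j i hji]
  · intro i j hij
    obtain ⟨⟨e, he, hce, hp, hii, hr⟩, -⟩ := hc i j hij
    exact ⟨e, he, by rw [hce, hup i j hij], hp, hii, hr⟩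
  · intro j
    obtain ⟨e, he, hce, hp, hδ⟩ := h.diag j
    exact ⟨e, he, by rw [hce, hdg], hp, hδ⟩
  · intro i j
    rcases lt_trichotomy i j with hij | rfl | hji
    · rw [if_pos hij, hup i j hij]; exact (hc i j hij).2
    · rw [if_neg (lt_irrefl i), hdg, sub_self, abs_zero, zero_mul]; exact hE0 i i
    · rw [if_neg (lt_asymm hji), hlo i j hji, hsym i j]; exact (hc j i hji).2

namespace SparseCholeskyRunFlush

/-- **The MEMBERS floor with STORED ZEROS CHARGED** (`lam_lo_members` / `lam_lo` of cap.ila.spd ≥ 0.2.1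
with `checks.eta_allowance = r_E`): under the hypotheses of
`SparseCholeskyRun.sub_sub_mul_lt_quadForm_of_rowCounts_members` for the floating-point matrix `A` —
row-count table `μ`, column norms `d`, Collatz pair `(v, c)` for the error matrix, shift `s`, symmetric
radius `Rad ≥ 0` with Collatz pair `(w, r)` — but with the factor only a FLUSH run (stored zeros with
`|s̃_{ij}| ≤ E_{ij}`, `E = Eᵀ ≥ 0`, Collatz pair `E v' ≤ r_E (1-u)^n v'`), EVERY `X` with `|X - A| ≤ Rad`
satisfies `(s - c - r - r_E)·yᵀy < yᵀXy` for `y ≠ 0`. [cite: Rump2026SparseI, Lemma 2.10 (2.15) with Thm 1.1 (1.4)]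
[cite: Rump2006, Corollary 2.7, (2.11)–(2.12) and (1.1)] -/
theorem sub_sub_mul_lt_quadForm_of_rowCounts_flush (hu : 0 ≤ u) (hu1 : u < 1)
    {A At R E : Matrix (Fin n) (Fin n) K} {S : Fin n → Fin n → Finset (Fin n)} (hAt : Atᵀ = At)
    (hE : Eᵀ = E) (hE0 : ∀ i j, 0 ≤ E i j) (hrun : SparseCholeskyRunFlush u E At R S)
    (hpos : ∀ j, 0 < R j j)
    {P : Fin n → Finset (Fin n)} (hSP : ∀ i j : Fin n, i ≤ j → S i j ⊆ P i ∩ P j)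
    (hPdiag : ∀ i, i ∈ P i) {μ : Fin n → ℕ} (hμ : ∀ i, (P i).card ≤ μ i)
    (hμu : ∀ i, ((μ i + 1 : ℕ) : K) * u < 1)
    {d : Fin n → K} (hd0 : ∀ j, 0 ≤ d j) (hd : ∀ j, (1 + gamma u (μ j + 1)) * At j j ≤ d j ^ 2)
    {v : Fin n → K} (hv : ∀ i, 0 < v i) {c : K}
    (hc : ∀ i, (errMatrix u (fun i j => min (μ i) (μ j) + 1) d *ᵥ v) i ≤ c * v i)
    {v' : Fin n → K} (hv' : ∀ i, 0 < v' i) {rE : K}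
    (hrE : ∀ i, (E *ᵥ v') i ≤ rE * (1 - u) ^ n * v' i)
    {s : K} (hoff : ∀ i j, i ≠ j → At i j = A i j) (hdiag : ∀ i, At i i ≤ A i i - s)
    {Rad : Matrix (Fin n) (Fin n) K} (hRad : Radᵀ = Rad) (hRad0 : ∀ i j, 0 ≤ Rad i j)
    {w : Fin n → K} (hw : ∀ i, 0 < w i) {r : K} (hr : ∀ i, (Rad *ᵥ w) i ≤ r * w i)
    (X : Matrix (Fin n) (Fin n) K) (hX : ∀ i j, |X i j - A i j| ≤ Rad i j)
    (y : Fin n → K) (hy : y ≠ 0) : (s - c - r - rE) * (y ⬝ᵥ y) < y ⬝ᵥ (X *ᵥ y) := by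
  have h1u : 0 < (1 - u) ^ n := pow_pos (by linarith) n
  have hEsym : ∀ i j, E i j = E j i := fun i j => by
    have := congrFun (congrFun hE j) i
    rwa [Matrix.transpose_apply] at this
  obtain ⟨A', hA', hrun', hdg, hbd⟩ := hrun.exists_sparseCholeskyRun hu hu1 hAt hE0
  let RadE : Matrix (Fin n) (Fin n) K := fun i j => E i j / (1 - u) ^ n
  let A0 : Matrix (Fin n) (Fin n) K := fun i j => A i j + (A' i j - At i j)
  have hRadE : RadEᵀ = RadE := by
    ext i j; simp only [RadE, Matrix.transpose_apply, hEsym i j]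
  have hRadE0 : ∀ i j, 0 ≤ RadE i j := fun i j => div_nonneg (hE0 i j) h1u.le
  have hrv : ∀ i, (RadE *ᵥ v') i ≤ rE * v' i := by
    intro i
    have hmv : (RadE *ᵥ v') i = (E *ᵥ v') i / (1 - u) ^ n := by
      simp only [RadE, Matrix.mulVec, dotProduct, Finset.sum_div]
      exact Finset.sum_congr rfl fun j _ => by ring
    rw [hmv, div_le_iff₀ h1u]
    calc (E *ᵥ v') i ≤ rE * (1 - u) ^ n * v' i := hrE i
      _ = rE * v' i * (1 - u) ^ n := by ring
  have hoff' : ∀ i j, i ≠ j → A' i j = A0 i j := fun i j hij => by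
    simp only [A0, hoff i j hij]; ring
  have hdiag' : ∀ i, A' i i ≤ A0 i i - s := fun i => by
    simp only [A0, hdg i]; linarith [hdiag i]
  have hd' : ∀ j, (1 + gamma u (μ j + 1)) * A' j j ≤ d j ^ 2 := fun j => by
    rw [hdg j]; exact hd j
  have hAA0 : ∀ i j, |A i j - A0 i j| ≤ RadE i j := by
    intro i j
    have h1 : |A i j - A0 i j| = |A' i j - At i j| := by
      simp only [A0]; rw [← abs_neg]; ring_nf
    rw [h1, le_div_iff₀ h1u]
    have h2 := hbd i j
    rcases lt_trichotomy i j with hij | rfl | hji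
    · simpa only [if_pos hij] using h2
    · simpa only [if_neg (lt_irrefl i)] using h2
    · simpa only [if_neg (lt_asymm hji), hEsym j i] using h2
  have hX0 : ∀ i j, |X i j - A0 i j| ≤ (Rad + RadE) i j := fun i j => by
    rw [Matrix.add_apply]
    calc |X i j - A0 i j| = |(X i j - A i j) + (A i j - A0 i j)| := by ring_nf
      _ ≤ |X i j - A i j| + |A i j - A0 i j| := abs_add_le _ _
      _ ≤ Rad i j + RadE i j := add_le_add (hX i j) (hAA0 i j)
  have h1 := hrun'.sub_mul_lt_quadForm_of_rowCounts hu hu1 hA' hpos hSP hPdiag hμ hμu hd0 hd' hv hc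
    hoff' hdiag' y hy
  have h3 := quadForm_sub_abs_le hX0 y
  have hsplit : (fun i => |y i|) ⬝ᵥ ((Rad + RadE) *ᵥ fun i => |y i|) =
      (fun i => |y i|) ⬝ᵥ (Rad *ᵥ fun i => |y i|) +
        (fun i => |y i|) ⬝ᵥ (RadE *ᵥ fun i => |y i|) := by
    rw [Matrix.add_mulVec, dotProduct_add]
  rw [hsplit] at h3
  have h4 := quadForm_le_of_mulVec_le hRad hRad0 hw hr (fun i => |y i|)
  have h5 := quadForm_le_of_mulVec_le hRadE hRadE0 hv' hrv (fun i => |y i|)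
  have hyy : (fun i => |y i|) ⬝ᵥ (fun i => |y i|) = y ⬝ᵥ y := by
    simp only [dotProduct]; exact sum_congr rfl fun i _ => abs_mul_abs_self _
  rw [hyy] at h4 h5
  nlinarith

/-- The charged floor as the NON-STRICT quadratic-form hypothesis a downstream bound consumes: any
`lam ≤ s - c - r - r_E` gives `lam·yᵀy ≤ yᵀXy` for ALL `y` and every member `X`.
[cite: Rump2026SparseI, Lemma 2.10 (2.15) with Section 1 (1.2)] [cite: Rump2006, Corollary 2.7] -/
theorem mul_le_quadForm_of_rowCounts_flush (hu : 0 ≤ u) (hu1 : u < 1)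
    {A At R E : Matrix (Fin n) (Fin n) K} {S : Fin n → Fin n → Finset (Fin n)} (hAt : Atᵀ = At)
    (hE : Eᵀ = E) (hE0 : ∀ i j, 0 ≤ E i j) (hrun : SparseCholeskyRunFlush u E At R S)
    (hpos : ∀ j, 0 < R j j)
    {P : Fin n → Finset (Fin n)} (hSP : ∀ i j : Fin n, i ≤ j → S i j ⊆ P i ∩ P j)
    (hPdiag : ∀ i, i ∈ P i) {μ : Fin n → ℕ} (hμ : ∀ i, (P i).card ≤ μ i)
    (hμu : ∀ i, ((μ i + 1 : ℕ) : K) * u < 1)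
    {d : Fin n → K} (hd0 : ∀ j, 0 ≤ d j) (hd : ∀ j, (1 + gamma u (μ j + 1)) * At j j ≤ d j ^ 2)
    {v : Fin n → K} (hv : ∀ i, 0 < v i) {c : K}
    (hc : ∀ i, (errMatrix u (fun i j => min (μ i) (μ j) + 1) d *ᵥ v) i ≤ c * v i)
    {v' : Fin n → K} (hv' : ∀ i, 0 < v' i) {rE : K}
    (hrE : ∀ i, (E *ᵥ v') i ≤ rE * (1 - u) ^ n * v' i)
    {s : K} (hoff : ∀ i j, i ≠ j → At i j = A i j) (hdiag : ∀ i, At i i ≤ A i i - s)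
    {Rad : Matrix (Fin n) (Fin n) K} (hRad : Radᵀ = Rad) (hRad0 : ∀ i j, 0 ≤ Rad i j)
    {w : Fin n → K} (hw : ∀ i, 0 < w i) {r : K} (hr : ∀ i, (Rad *ᵥ w) i ≤ r * w i)
    {lam : K} (hlam : lam ≤ s - c - r - rE)
    (X : Matrix (Fin n) (Fin n) K) (hX : ∀ i j, |X i j - A i j| ≤ Rad i j)
    (y : Fin n → K) : lam * (y ⬝ᵥ y) ≤ y ⬝ᵥ (X *ᵥ y) := by
  have hxx : 0 ≤ y ⬝ᵥ y := sum_nonneg fun i _ => mul_self_nonneg _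
  by_cases hy : y = 0
  · rw [hy]; simp
  · have h := hrun.sub_sub_mul_lt_quadForm_of_rowCounts_flush hu hu1 hAt hE hE0 hpos hSP hPdiag hμ
      hμu hd0 hd hv hc hv' hrE hoff hdiag hRad hRad0 hw hr X hX y hy
    nlinarith [mul_le_mul_of_nonneg_right hlam hxx]

end SparseCholeskyRunFlush

end Flush

end Literature.ComputerArithmetic.Rump2026SparseI
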